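import Summits.CriticalPhenomena.PercolationContinuityZ3.Theorems.PercNearOneGluingNoHeavyLowerTailThreePartitionTwistedUniv

/-!
# `NoHeavyLowerTail` (crux stmt-CriticalPhenomena-4575): the TWISTED CONE STEP along a coordinate outside the twist
# (`e ∉ τ`, 'digit 1'): `N_τ(𝒰ᵉ,𝒱ᵉ,𝒲ᵉ) ≤ 3·N_τ(𝒰,𝒱,𝒲)` when every member of `𝒰` contains `e`

Support file (lane `prim-ineq-gen-4`, generation 15; `--supports stmt-CriticalPhenomena-4575`).  Pure proofs, no definitions, no `sorry`, standard axioms.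
This is the twisted (`…ThreePartitionADTwisted`, copies `S_a ∆ τ`) version of `…ThreePartitionPrincipal.threePartN_lift_le_three_mul` for a pinned
element `e ∉ τ`: the twist commutes with inserting/deleting `e` (`insert_symmDiff_of_notMem`, `sdiff_symmDiff_of_notMem`, `mem_symmDiff_iff_of_notMem`), so
the untwisted proof goes through word for word with every membership read on the twisted copy and the fibrewise four-functions step taken from
`teeT_le_deeT`.  Consequence (`threePartNT_principal_nonneg_of_disjoint`): `0 ≤ threePartNT τ {T | S ⊆ T} 𝒱 𝒲` for all up-sets `𝒱, 𝒲` whenever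
`S ∩ τ = ∅` (induction on `S`, base `threePartNT_univ_nonneg`).  The complementary 'digit 2' step (`e ∈ τ`; = the lane's Theorem C `c₂ ≥ 2c₃` on the
empty-bottom face, memo §5(a)) is what remains for the full one-principal-slot comb positivity. HONEST LABEL: a face, not the conjecture. [this work]
-/

noncomputable section

open Finset
open scoped symmDiff Classical

namespace Summit.CriticalPhenomena.PercolationContinuityZ3.Theorems.ThreePartition

variable {ι : Type*} [Fintype ι]

/-! ## The twist commutes with the pinned element when `e ∉ τ` -/

omit [Fintype ι] in
/-- `e ∉ τ`: `(insert e S) ∆ τ = insert e (S ∆ τ)`. [folklore] -/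
theorem insert_symmDiff_of_notMem {e : ι} {τ : Set ι} (h : e ∉ τ) (S : Set ι) : insert e S ∆ τ = insert e (S ∆ τ) := by
  ext x
  simp only [Set.mem_symmDiff, Set.mem_insert_iff]
  by_cases hx : x = e
  · subst hx; tauto
  · tauto

omit [Fintype ι] in
/-- `e ∉ τ`: `(S ∖ e) ∆ τ = (S ∆ τ) ∖ e`. [folklore] -/
theorem sdiff_symmDiff_of_notMem {e : ι} {τ : Set ι} (h : e ∉ τ) (S : Set ι) : (S \ {e}) ∆ τ = (S ∆ τ) \ {e} := by
  ext x
  simp only [Set.mem_symmDiff, Set.mem_sdiff, Set.mem_singleton_iff]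
  by_cases hx : x = e
  · subst hx; tauto
  · tauto

omit [Fintype ι] in
/-- `e ∉ τ`: `e ∈ S ∆ τ ↔ e ∈ S`. [folklore] -/
theorem mem_symmDiff_iff_of_notMem {e : ι} {τ : Set ι} (h : e ∉ τ) (S : Set ι) : e ∈ S ∆ τ ↔ e ∈ S := by
  simp only [Set.mem_symmDiff]; tauto

/-- `teeT` is symmetric in its first two families. [this work] -/
theorem teeT_swap12 (τ : Set ι) (𝒳 𝒴 𝒵 : Set (Set ι)) : teeT τ 𝒳 𝒴 𝒵 = teeT τ 𝒴 𝒳 𝒵 := by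
  unfold teeT triT
  rw [tri_swap12]
  exact tri_congr fun _ _ _ => by tauto

/-- `teeT` is symmetric in its first and third families. [this work] -/
theorem teeT_swap13 (τ : Set ι) (𝒳 𝒴 𝒵 : Set (Set ι)) : teeT τ 𝒳 𝒴 𝒵 = teeT τ 𝒵 𝒴 𝒳 := by
  unfold teeT triT
  rw [tri_swap13]
  exact tri_congr fun _ _ _ => by tauto

/-! ## The twisted cone step for `e ∉ τ` -/

section TwistedConeStep

variable (τ : Set ι) (e : ι) {𝒰 𝒱 𝒲 : Set (Set ι)}

/-- `topT` of the original triple as a pinned count. [this work] -/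
theorem topT_eq_pin (heτ : e ∉ τ) (h𝒰e : ∀ T ∈ 𝒰, e ∈ T) :
    topT τ (𝒰 ∩ 𝒱 ∩ 𝒲) = tri (fun _ S₂ S₃ => e ∈ S₂ ∧ S₃ ∆ τ ∈ {R : Set ι | insert e R ∈ 𝒰 ∩ 𝒱 ∩ 𝒲}) := by
  unfold topT triT
  rw [show tri (fun _ _ S₃ => S₃ ∆ τ ∈ 𝒰 ∩ 𝒱 ∩ 𝒲) = tri (fun S₁ S₂ S₃ => e ∈ S₃ ∧ (fun (_ _ S₃ : Set ι) => S₃ ∆ τ ∈ 𝒰 ∩ 𝒱 ∩ 𝒲) S₁ S₂ S₃) from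
    tri_congr fun S₁ S₂ _ => ⟨fun h => ⟨(mem_symmDiff_iff_of_notMem heτ _).1 (h𝒰e _ h.1.1), h⟩, fun h => h.2⟩]
  rw [tri_move32]
  exact tri_congr fun S₁ S₂ _ => by simp only [insert_symmDiff_of_notMem heτ, Set.mem_setOf_eq]

/-- `topT` of the lifted triple is three times the pinned count. [this work] -/
theorem topT_lift_eq_three_mul (heτ : e ∉ τ) :
    topT τ ({R : Set ι | insert e R ∈ 𝒰} ∩ {R : Set ι | insert e R ∈ 𝒱} ∩ {R : Set ι | insert e R ∈ 𝒲})
      = 3 * tri (fun _ S₂ S₃ => e ∈ S₂ ∧ S₃ ∆ τ ∈ {R : Set ι | insert e R ∈ 𝒰 ∩ 𝒱 ∩ 𝒲}) := by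
  unfold topT triT
  rw [tri_eq_three_mul_pin e]
  · rfl
  · intro _ _ _; exact Iff.rfl
  · intro _ _ S₃
    show insert e S₃ ∆ τ ∈ {R : Set ι | insert e R ∈ 𝒰 ∩ 𝒱 ∩ 𝒲} ↔ S₃ ∆ τ ∈ {R : Set ι | insert e R ∈ 𝒰 ∩ 𝒱 ∩ 𝒲}
    rw [insert_symmDiff_of_notMem heτ]; exact insert_mem_liftAt_iff e _ _

/-- `deeT(𝒰, 𝒱∩𝒲)` is at most the pinned lifted count. [this work] -/
theorem deeT_one_le_pin (heτ : e ∉ τ) (h𝒰e : ∀ T ∈ 𝒰, e ∈ T) (h𝒱 : IsUpperSet 𝒱) (h𝒲 : IsUpperSet 𝒲) :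
    deeT τ 𝒰 (𝒱 ∩ 𝒲) ≤ tri (fun S₁ S₂ S₃ => e ∈ S₂ ∧ (S₁ ∆ τ ∈ {R : Set ι | insert e R ∈ 𝒰} ∧ S₃ ∆ τ ∈ {R : Set ι | insert e R ∈ 𝒱} ∩ {R : Set ι | insert e R ∈ 𝒲})) := by
  unfold deeT triT
  rw [show tri (fun S₁ _ S₃ => S₁ ∆ τ ∈ 𝒰 ∧ S₃ ∆ τ ∈ 𝒱 ∩ 𝒲) = tri (fun S₁ S₂ S₃ => e ∈ S₁ ∧ (fun (S₁ _ S₃ : Set ι) => S₁ ∆ τ ∈ 𝒰 ∧ S₃ ∆ τ ∈ 𝒱 ∩ 𝒲) S₁ S₂ S₃) from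
    tri_congr fun S₁ S₂ _ => ⟨fun h => ⟨(mem_symmDiff_iff_of_notMem heτ _).1 (h𝒰e _ h.1), h⟩, fun h => h.2⟩]
  rw [tri_move12]
  refine tri_mono fun S₁ S₂ _ h => ⟨h.1, ?_, ?_⟩
  · have h2 := h.2.1; rw [insert_symmDiff_of_notMem heτ] at h2; exact h2
  · exact mem_liftAt_of_mem e (h𝒱.inter h𝒲) h.2.2

/-- `deeT` of the lifted triple (first slot) is three times the pinned count. [this work] -/
theorem deeT_one_lift_eq_three_mul (heτ : e ∉ τ) :
    deeT τ ({R : Set ι | insert e R ∈ 𝒰}) ({R : Set ι | insert e R ∈ 𝒱} ∩ {R : Set ι | insert e R ∈ 𝒲})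
      = 3 * tri (fun S₁ S₂ S₃ => e ∈ S₂ ∧ (S₁ ∆ τ ∈ {R : Set ι | insert e R ∈ 𝒰} ∧ S₃ ∆ τ ∈ {R : Set ι | insert e R ∈ 𝒱} ∩ {R : Set ι | insert e R ∈ 𝒲})) := by
  unfold deeT triT
  rw [tri_eq_three_mul_pin e]
  · intro S₁ _ S₃
    show insert e S₁ ∆ τ ∈ {R : Set ι | insert e R ∈ 𝒰} ∧ S₃ ∆ τ ∈ _ ↔ S₁ ∆ τ ∈ {R : Set ι | insert e R ∈ 𝒰} ∧ S₃ ∆ τ ∈ _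
    rw [insert_symmDiff_of_notMem heτ, insert_mem_liftAt_iff]
  · intro S₁ _ S₃
    show S₁ ∆ τ ∈ {R : Set ι | insert e R ∈ 𝒰} ∧ insert e S₃ ∆ τ ∈ {R : Set ι | insert e R ∈ 𝒱} ∩ {R : Set ι | insert e R ∈ 𝒲}
      ↔ S₁ ∆ τ ∈ {R : Set ι | insert e R ∈ 𝒰} ∧ S₃ ∆ τ ∈ {R : Set ι | insert e R ∈ 𝒱} ∩ {R : Set ι | insert e R ∈ 𝒲}
    rw [insert_symmDiff_of_notMem heτ, ← liftAt_inter, insert_mem_liftAt_iff]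

/-- `deeT(𝒱, 𝒰∩𝒲)` as a pinned count. [this work] -/
theorem deeT_two_eq_pin (heτ : e ∉ τ) (h𝒰e : ∀ T ∈ 𝒰, e ∈ T) :
    deeT τ 𝒱 (𝒰 ∩ 𝒲) = tri (fun S₁ S₂ S₃ => e ∈ S₂ ∧ (S₁ ∆ τ ∈ 𝒱 ∧ S₃ ∆ τ ∈ {R : Set ι | insert e R ∈ 𝒰 ∩ 𝒲})) := by
  unfold deeT triT
  rw [show tri (fun S₁ _ S₃ => S₁ ∆ τ ∈ 𝒱 ∧ S₃ ∆ τ ∈ 𝒰 ∩ 𝒲) = tri (fun S₁ S₂ S₃ => e ∈ S₃ ∧ (fun (S₁ _ S₃ : Set ι) => S₁ ∆ τ ∈ 𝒱 ∧ S₃ ∆ τ ∈ 𝒰 ∩ 𝒲) S₁ S₂ S₃) from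
    tri_congr fun S₁ S₂ _ => ⟨fun h => ⟨(mem_symmDiff_iff_of_notMem heτ _).1 (h𝒰e _ h.2.1), h⟩, fun h => h.2⟩]
  rw [tri_move32]
  exact tri_congr fun S₁ S₂ _ => by simp only [insert_symmDiff_of_notMem heτ, Set.mem_setOf_eq]

/-- `deeT` of the lifted triple (second slot) is three times the pinned count. [this work] -/
theorem deeT_two_lift_eq_three_mul (heτ : e ∉ τ) :
    deeT τ ({R : Set ι | insert e R ∈ 𝒱}) ({R : Set ι | insert e R ∈ 𝒰} ∩ {R : Set ι | insert e R ∈ 𝒲})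
      = 3 * tri (fun S₁ S₂ S₃ => e ∈ S₂ ∧ (S₁ ∆ τ ∈ {R : Set ι | insert e R ∈ 𝒱} ∧ S₃ ∆ τ ∈ {R : Set ι | insert e R ∈ 𝒰} ∩ {R : Set ι | insert e R ∈ 𝒲})) := by
  unfold deeT triT
  rw [tri_eq_three_mul_pin e]
  · intro S₁ _ S₃
    show insert e S₁ ∆ τ ∈ {R : Set ι | insert e R ∈ 𝒱} ∧ S₃ ∆ τ ∈ _ ↔ S₁ ∆ τ ∈ {R : Set ι | insert e R ∈ 𝒱} ∧ S₃ ∆ τ ∈ _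
    rw [insert_symmDiff_of_notMem heτ, insert_mem_liftAt_iff]
  · intro S₁ _ S₃
    show S₁ ∆ τ ∈ {R : Set ι | insert e R ∈ 𝒱} ∧ insert e S₃ ∆ τ ∈ {R : Set ι | insert e R ∈ 𝒰} ∩ {R : Set ι | insert e R ∈ 𝒲}
      ↔ S₁ ∆ τ ∈ {R : Set ι | insert e R ∈ 𝒱} ∧ S₃ ∆ τ ∈ {R : Set ι | insert e R ∈ 𝒰} ∩ {R : Set ι | insert e R ∈ 𝒲}
    rw [insert_symmDiff_of_notMem heτ, ← liftAt_inter, insert_mem_liftAt_iff]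

/-- The increment of the second slot pays: `d₂ + g₂ ≤ d₂ᵉ`. [this work] -/
theorem deeT_two_add_gain_le (h𝒱 : IsUpperSet 𝒱) :
    tri (fun S₁ S₂ S₃ => e ∈ S₂ ∧ (S₁ ∆ τ ∈ 𝒱 ∧ S₃ ∆ τ ∈ {R : Set ι | insert e R ∈ 𝒰 ∩ 𝒲}))
      + tri (fun S₁ S₂ S₃ => e ∈ S₂ ∧ ((S₁ ∆ τ ∈ {R : Set ι | insert e R ∈ 𝒱} ∧ S₁ ∆ τ ∉ 𝒱) ∧ S₃ ∆ τ ∈ {R : Set ι | insert e R ∈ 𝒰} ∩ {R : Set ι | insert e R ∈ 𝒲}))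
      ≤ tri (fun S₁ S₂ S₃ => e ∈ S₂ ∧ (S₁ ∆ τ ∈ {R : Set ι | insert e R ∈ 𝒱} ∧ S₃ ∆ τ ∈ {R : Set ι | insert e R ∈ 𝒰} ∩ {R : Set ι | insert e R ∈ 𝒲})) := by
  refine tri_add_le (fun S₁ S₂ S₃ h => ⟨h.1, mem_liftAt_of_mem e h𝒱 h.2.1, ?_⟩) (fun S₁ S₂ S₃ h => ⟨h.1, h.2.1.1, h.2.2⟩)
    (fun S₁ S₂ S₃ h h' => h'.2.1.2 h.2.1)
  rw [← liftAt_inter]; exact h.2.2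

/-- `teeT(𝒰,𝒱,𝒲)` as a pinned count. [this work] -/
theorem teeT_eq_pin (heτ : e ∉ τ) (h𝒰e : ∀ T ∈ 𝒰, e ∈ T) :
    teeT τ 𝒰 𝒱 𝒲 = tri (fun S₁ S₂ S₃ => e ∈ S₂ ∧ (S₁ ∆ τ ∈ {R : Set ι | insert e R ∈ 𝒰} ∧ (S₂ ∆ τ) \ {e} ∈ 𝒱 ∧ S₃ ∆ τ ∈ 𝒲)) := by
  unfold teeT triT
  rw [show tri (fun S₁ S₂ S₃ => S₁ ∆ τ ∈ 𝒰 ∧ S₂ ∆ τ ∈ 𝒱 ∧ S₃ ∆ τ ∈ 𝒲) = tri (fun S₁ S₂ S₃ => e ∈ S₁ ∧ (fun (S₁ S₂ S₃ : Set ι) => S₁ ∆ τ ∈ 𝒰 ∧ S₂ ∆ τ ∈ 𝒱 ∧ S₃ ∆ τ ∈ 𝒲) S₁ S₂ S₃) from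
    tri_congr fun S₁ S₂ _ => ⟨fun h => ⟨(mem_symmDiff_iff_of_notMem heτ _).1 (h𝒰e _ h.1), h⟩, fun h => h.2⟩]
  rw [tri_move12]
  exact tri_congr fun S₁ S₂ _ => by simp only [insert_symmDiff_of_notMem heτ, sdiff_symmDiff_of_notMem heτ, Set.mem_setOf_eq]

/-- `teeT` of the lifted triple is three times a pinned count. [this work] -/
theorem teeT_lift_eq_three_mul (heτ : e ∉ τ) :
    teeT τ ({R : Set ι | insert e R ∈ 𝒰}) ({R : Set ι | insert e R ∈ 𝒱}) ({R : Set ι | insert e R ∈ 𝒲})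
      = 3 * tri (fun S₁ S₂ S₃ => e ∈ S₂ ∧ (S₁ ∆ τ ∈ {R : Set ι | insert e R ∈ 𝒰} ∧ S₂ ∆ τ ∈ 𝒱 ∧ S₃ ∆ τ ∈ {R : Set ι | insert e R ∈ 𝒲})) := by
  unfold teeT triT
  rw [tri_eq_three_mul_pin e]
  · congr 1
    refine tri_congr fun S₁ S₂ _ => ?_
    have key : ∀ (he : e ∈ S₂), (S₂ ∆ τ ∈ {R : Set ι | insert e R ∈ 𝒱} ↔ S₂ ∆ τ ∈ 𝒱) :=
      fun he => mem_liftAt_iff_of_mem 𝒱 ((mem_symmDiff_iff_of_notMem heτ _).2 he)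
    constructor
    · rintro ⟨he, h1, h2, h3⟩; exact ⟨he, h1, (key he).1 h2, h3⟩
    · rintro ⟨he, h1, h2, h3⟩; exact ⟨he, h1, (key he).2 h2, h3⟩
  · intro S₁ S₂ S₃
    show insert e S₁ ∆ τ ∈ {R : Set ι | insert e R ∈ 𝒰} ∧ (S₂ \ {e}) ∆ τ ∈ {R : Set ι | insert e R ∈ 𝒱} ∧ S₃ ∆ τ ∈ {R : Set ι | insert e R ∈ 𝒲}
      ↔ S₁ ∆ τ ∈ {R : Set ι | insert e R ∈ 𝒰} ∧ S₂ ∆ τ ∈ {R : Set ι | insert e R ∈ 𝒱} ∧ S₃ ∆ τ ∈ {R : Set ι | insert e R ∈ 𝒲}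
    rw [insert_symmDiff_of_notMem heτ, sdiff_symmDiff_of_notMem heτ, insert_mem_liftAt_iff, diff_mem_liftAt_iff]
  · intro S₁ S₂ S₃
    show S₁ ∆ τ ∈ {R : Set ι | insert e R ∈ 𝒰} ∧ (S₂ \ {e}) ∆ τ ∈ {R : Set ι | insert e R ∈ 𝒱} ∧ insert e S₃ ∆ τ ∈ {R : Set ι | insert e R ∈ 𝒲}
      ↔ S₁ ∆ τ ∈ {R : Set ι | insert e R ∈ 𝒰} ∧ S₂ ∆ τ ∈ {R : Set ι | insert e R ∈ 𝒱} ∧ S₃ ∆ τ ∈ {R : Set ι | insert e R ∈ 𝒲}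
    rw [insert_symmDiff_of_notMem heτ, sdiff_symmDiff_of_notMem heτ, insert_mem_liftAt_iff, diff_mem_liftAt_iff]

/-- The pinned lifted `teeT` exceeds the pinned original `teeT` by at most the two increment counts. [this work] -/
theorem teeT_pin_le_add (heτ : e ∉ τ) :
    tri (fun S₁ S₂ S₃ => e ∈ S₂ ∧ (S₁ ∆ τ ∈ {R : Set ι | insert e R ∈ 𝒰} ∧ S₂ ∆ τ ∈ 𝒱 ∧ S₃ ∆ τ ∈ {R : Set ι | insert e R ∈ 𝒲}))
      ≤ tri (fun S₁ S₂ S₃ => e ∈ S₂ ∧ (S₁ ∆ τ ∈ {R : Set ι | insert e R ∈ 𝒰} ∧ (S₂ ∆ τ) \ {e} ∈ 𝒱 ∧ S₃ ∆ τ ∈ 𝒲))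
        + tri (fun S₁ S₂ S₃ => e ∈ S₂ ∧ (S₁ ∆ τ ∈ {R : Set ι | insert e R ∈ 𝒰} ∧ ((S₂ ∆ τ) \ {e} ∈ {R : Set ι | insert e R ∈ 𝒱} ∧ (S₂ ∆ τ) \ {e} ∉ 𝒱) ∧ S₃ ∆ τ ∈ {R : Set ι | insert e R ∈ 𝒲}))
        + tri (fun S₁ S₂ S₃ => e ∈ S₂ ∧ (S₁ ∆ τ ∈ {R : Set ι | insert e R ∈ 𝒰} ∧ (S₂ ∆ τ) \ {e} ∈ 𝒱 ∧ (S₃ ∆ τ ∈ {R : Set ι | insert e R ∈ 𝒲} ∧ S₃ ∆ τ ∉ 𝒲))) := by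
  refine tri_le_add₃ fun S₁ S₂ S₃ h => ?_
  obtain ⟨he, h1, h2, h3⟩ := h
  by_cases hV : (S₂ ∆ τ) \ {e} ∈ 𝒱
  · by_cases hW : S₃ ∆ τ ∈ 𝒲
    · exact Or.inl ⟨he, h1, hV, hW⟩
    · exact Or.inr (Or.inr ⟨he, h1, hV, h3, hW⟩)
  · refine Or.inr (Or.inl ⟨he, h1, ⟨?_, hV⟩, h3⟩)
    rw [diff_mem_liftAt_iff, mem_liftAt_iff_of_mem 𝒱 ((mem_symmDiff_iff_of_notMem heτ _).2 he)]; exact h2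

/-- The second-slot increment pays for `X` (twisted Kleitman `teeT_le_deeT` on the increment family). [this work] -/
theorem incrT_two_le (heτ : e ∉ τ) (h𝒰 : IsUpperSet 𝒰) (h𝒲 : IsUpperSet 𝒲) :
    tri (fun S₁ S₂ S₃ => e ∈ S₂ ∧ (S₁ ∆ τ ∈ {R : Set ι | insert e R ∈ 𝒰} ∧ ((S₂ ∆ τ) \ {e} ∈ {R : Set ι | insert e R ∈ 𝒱} ∧ (S₂ ∆ τ) \ {e} ∉ 𝒱) ∧ S₃ ∆ τ ∈ {R : Set ι | insert e R ∈ 𝒲}))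
      ≤ tri (fun S₁ S₂ S₃ => e ∈ S₂ ∧ ((S₁ ∆ τ ∈ {R : Set ι | insert e R ∈ 𝒱} ∧ S₁ ∆ τ ∉ 𝒱) ∧ S₃ ∆ τ ∈ {R : Set ι | insert e R ∈ 𝒰} ∩ {R : Set ι | insert e R ∈ 𝒲})) := by
  set 𝒟 : Set (Set ι) := {T | e ∈ T ∧ (T \ {e} ∈ {R : Set ι | insert e R ∈ 𝒱} ∧ T \ {e} ∉ 𝒱)} with h𝒟
  have step1 : tri (fun S₁ S₂ S₃ => e ∈ S₂ ∧ (S₁ ∆ τ ∈ {R : Set ι | insert e R ∈ 𝒰} ∧ ((S₂ ∆ τ) \ {e} ∈ {R : Set ι | insert e R ∈ 𝒱} ∧ (S₂ ∆ τ) \ {e} ∉ 𝒱) ∧ S₃ ∆ τ ∈ {R : Set ι | insert e R ∈ 𝒲}))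
      ≤ teeT τ ({R : Set ι | insert e R ∈ 𝒰}) 𝒟 ({R : Set ι | insert e R ∈ 𝒲}) := by
    unfold teeT triT
    exact tri_mono fun S₁ S₂ _ h => ⟨h.2.1, ⟨(mem_symmDiff_iff_of_notMem heτ _).2 h.1, h.2.2.1⟩, h.2.2.2⟩
  have step2 : teeT τ ({R : Set ι | insert e R ∈ 𝒰}) 𝒟 ({R : Set ι | insert e R ∈ 𝒲}) = teeT τ 𝒟 ({R : Set ι | insert e R ∈ 𝒰}) ({R : Set ι | insert e R ∈ 𝒲}) :=
    teeT_swap12 τ _ _ _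
  have step3 : teeT τ 𝒟 ({R : Set ι | insert e R ∈ 𝒰}) ({R : Set ι | insert e R ∈ 𝒲}) ≤ deeT τ 𝒟 ({R : Set ι | insert e R ∈ 𝒰} ∩ {R : Set ι | insert e R ∈ 𝒲}) :=
    teeT_le_deeT τ 𝒟 (isUpperSet_liftAt e h𝒰) (isUpperSet_liftAt e h𝒲)
  have step4 : deeT τ 𝒟 ({R : Set ι | insert e R ∈ 𝒰} ∩ {R : Set ι | insert e R ∈ 𝒲})
      = tri (fun S₁ S₂ S₃ => e ∈ S₂ ∧ ((S₁ ∆ τ ∈ {R : Set ι | insert e R ∈ 𝒱} ∧ S₁ ∆ τ ∉ 𝒱) ∧ S₃ ∆ τ ∈ {R : Set ι | insert e R ∈ 𝒰} ∩ {R : Set ι | insert e R ∈ 𝒲})) := by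
    unfold deeT triT
    rw [show tri (fun S₁ _ S₃ => S₁ ∆ τ ∈ 𝒟 ∧ S₃ ∆ τ ∈ {R : Set ι | insert e R ∈ 𝒰} ∩ {R : Set ι | insert e R ∈ 𝒲})
        = tri (fun S₁ S₂ S₃ => e ∈ S₁ ∧ (fun (S₁ _ S₃ : Set ι) => ((S₁ ∆ τ) \ {e} ∈ {R : Set ι | insert e R ∈ 𝒱} ∧ (S₁ ∆ τ) \ {e} ∉ 𝒱) ∧ S₃ ∆ τ ∈ {R : Set ι | insert e R ∈ 𝒰} ∩ {R : Set ι | insert e R ∈ 𝒲}) S₁ S₂ S₃) from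
      tri_congr fun S₁ S₂ _ => by rw [h𝒟]; simp only [Set.mem_setOf_eq, mem_symmDiff_iff_of_notMem heτ]; tauto]
    rw [tri_move12]
    refine tri_congr fun S₁ S₂ hd => ?_
    have aux : ∀ (he : e ∈ S₂), (insert e S₁ ∆ τ) \ {e} = S₁ ∆ τ := by
      intro he
      have he1 : e ∉ S₁ := fun h => Set.disjoint_left.1 hd h he
      rw [insert_symmDiff_of_notMem heτ, insert_sdiff_singleton_of_notMem]
      exact fun h => he1 ((mem_symmDiff_iff_of_notMem heτ _).1 h)
    constructor
    · rintro ⟨he, hA, hC⟩; rw [aux he] at hA; exact ⟨he, hA, hC⟩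
    · rintro ⟨he, hA, hC⟩; refine ⟨he, ?_, hC⟩; rw [aux he]; exact hA
  calc _ ≤ _ := step1
    _ = _ := step2
    _ ≤ _ := step3
    _ = _ := step4

/-- The third-slot increment pays for `Y`. [this work] -/
theorem incrT_three_le (heτ : e ∉ τ) (h𝒰 : IsUpperSet 𝒰) (h𝒱 : IsUpperSet 𝒱) :
    tri (fun S₁ S₂ S₃ => e ∈ S₂ ∧ (S₁ ∆ τ ∈ {R : Set ι | insert e R ∈ 𝒰} ∧ (S₂ ∆ τ) \ {e} ∈ 𝒱 ∧ (S₃ ∆ τ ∈ {R : Set ι | insert e R ∈ 𝒲} ∧ S₃ ∆ τ ∉ 𝒲)))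
      ≤ tri (fun S₁ S₂ S₃ => e ∈ S₂ ∧ ((S₁ ∆ τ ∈ {R : Set ι | insert e R ∈ 𝒲} ∧ S₁ ∆ τ ∉ 𝒲) ∧ S₃ ∆ τ ∈ {R : Set ι | insert e R ∈ 𝒰} ∩ {R : Set ι | insert e R ∈ 𝒱})) := by
  set 𝒟 : Set (Set ι) := {T | e ∈ T ∧ (T \ {e} ∈ {R : Set ι | insert e R ∈ 𝒲} ∧ T \ {e} ∉ 𝒲)} with h𝒟
  have step0 : tri (fun S₁ S₂ S₃ => e ∈ S₂ ∧ (S₁ ∆ τ ∈ {R : Set ι | insert e R ∈ 𝒰} ∧ (S₂ ∆ τ) \ {e} ∈ 𝒱 ∧ (S₃ ∆ τ ∈ {R : Set ι | insert e R ∈ 𝒲} ∧ S₃ ∆ τ ∉ 𝒲)))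
      = tri (fun S₁ S₂ S₃ => e ∈ S₃ ∧ (fun (S₁ S₂ S₃ : Set ι) => S₁ ∆ τ ∈ {R : Set ι | insert e R ∈ 𝒰} ∧ S₂ ∆ τ ∈ 𝒱 ∧ (S₃ ∆ τ ∈ {R : Set ι | insert e R ∈ 𝒲} ∧ (S₃ ∆ τ) \ {e} ∉ 𝒲)) S₁ S₂ S₃) := by
    rw [tri_move32]
    refine tri_congr fun S₁ S₂ hd => ?_
    have eq2 : (S₂ \ {e}) ∆ τ = (S₂ ∆ τ) \ {e} := sdiff_symmDiff_of_notMem heτ _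
    have eq3 : insert e (S₁ ∪ S₂)ᶜ ∆ τ = insert e ((S₁ ∪ S₂)ᶜ ∆ τ) := insert_symmDiff_of_notMem heτ _
    constructor
    · rintro ⟨he, h1, h2, h3, h4⟩
      have he3 : e ∉ (S₁ ∪ S₂)ᶜ ∆ τ := fun h => ((mem_symmDiff_iff_of_notMem heτ _).1 h) (Or.inr he)
      refine ⟨he, h1, ?_, ?_, ?_⟩
      · rw [eq2]; exact h2
      · rw [eq3, insert_mem_liftAt_iff]; exact h3
      · rw [eq3, insert_sdiff_singleton_of_notMem he3]; exact h4
    · rintro ⟨he, h1, h2, h3, h4⟩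
      have he3 : e ∉ (S₁ ∪ S₂)ᶜ ∆ τ := fun h => ((mem_symmDiff_iff_of_notMem heτ _).1 h) (Or.inr he)
      refine ⟨he, h1, ?_, ?_, ?_⟩
      · rw [eq2] at h2; exact h2
      · rw [eq3, insert_mem_liftAt_iff] at h3; exact h3
      · rw [eq3, insert_sdiff_singleton_of_notMem he3] at h4; exact h4
  have step1 : tri (fun S₁ S₂ S₃ => e ∈ S₃ ∧ (fun (S₁ S₂ S₃ : Set ι) => S₁ ∆ τ ∈ {R : Set ι | insert e R ∈ 𝒰} ∧ S₂ ∆ τ ∈ 𝒱 ∧ (S₃ ∆ τ ∈ {R : Set ι | insert e R ∈ 𝒲} ∧ (S₃ ∆ τ) \ {e} ∉ 𝒲)) S₁ S₂ S₃)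
      ≤ teeT τ ({R : Set ι | insert e R ∈ 𝒰}) ({R : Set ι | insert e R ∈ 𝒱}) 𝒟 := by
    unfold teeT triT
    refine tri_mono fun S₁ S₂ _ h => ⟨h.2.1, mem_liftAt_of_mem e h𝒱 h.2.2.1, ⟨(mem_symmDiff_iff_of_notMem heτ _).2 h.1, ?_, h.2.2.2.2⟩⟩
    rw [diff_mem_liftAt_iff]; exact h.2.2.2.1
  have step2 : teeT τ ({R : Set ι | insert e R ∈ 𝒰}) ({R : Set ι | insert e R ∈ 𝒱}) 𝒟 = teeT τ 𝒟 ({R : Set ι | insert e R ∈ 𝒱}) ({R : Set ι | insert e R ∈ 𝒰}) :=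
    teeT_swap13 τ _ _ _
  have step3 : teeT τ 𝒟 ({R : Set ι | insert e R ∈ 𝒱}) ({R : Set ι | insert e R ∈ 𝒰}) ≤ deeT τ 𝒟 ({R : Set ι | insert e R ∈ 𝒱} ∩ {R : Set ι | insert e R ∈ 𝒰}) :=
    teeT_le_deeT τ 𝒟 (isUpperSet_liftAt e h𝒱) (isUpperSet_liftAt e h𝒰)
  have step4 : deeT τ 𝒟 ({R : Set ι | insert e R ∈ 𝒱} ∩ {R : Set ι | insert e R ∈ 𝒰})
      = tri (fun S₁ S₂ S₃ => e ∈ S₂ ∧ ((S₁ ∆ τ ∈ {R : Set ι | insert e R ∈ 𝒲} ∧ S₁ ∆ τ ∉ 𝒲) ∧ S₃ ∆ τ ∈ {R : Set ι | insert e R ∈ 𝒰} ∩ {R : Set ι | insert e R ∈ 𝒱})) := by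
    unfold deeT triT
    rw [show tri (fun S₁ _ S₃ => S₁ ∆ τ ∈ 𝒟 ∧ S₃ ∆ τ ∈ {R : Set ι | insert e R ∈ 𝒱} ∩ {R : Set ι | insert e R ∈ 𝒰})
        = tri (fun S₁ S₂ S₃ => e ∈ S₁ ∧ (fun (S₁ _ S₃ : Set ι) => ((S₁ ∆ τ) \ {e} ∈ {R : Set ι | insert e R ∈ 𝒲} ∧ (S₁ ∆ τ) \ {e} ∉ 𝒲) ∧ S₃ ∆ τ ∈ {R : Set ι | insert e R ∈ 𝒰} ∩ {R : Set ι | insert e R ∈ 𝒱}) S₁ S₂ S₃) from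
      tri_congr fun S₁ S₂ _ => by
        rw [h𝒟, Set.inter_comm]; simp only [Set.mem_setOf_eq, mem_symmDiff_iff_of_notMem heτ]; tauto]
    rw [tri_move12]
    refine tri_congr fun S₁ S₂ hd => ?_
    have aux : ∀ (he : e ∈ S₂), (insert e S₁ ∆ τ) \ {e} = S₁ ∆ τ := by
      intro he
      have he1 : e ∉ S₁ := fun h => Set.disjoint_left.1 hd h he
      rw [insert_symmDiff_of_notMem heτ, insert_sdiff_singleton_of_notMem]
      exact fun h => he1 ((mem_symmDiff_iff_of_notMem heτ _).1 h)
    constructor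
    · rintro ⟨he, hA, hC⟩; rw [aux he] at hA; exact ⟨he, hA, hC⟩
    · rintro ⟨he, hA, hC⟩; refine ⟨he, ?_, hC⟩; rw [aux he]; exact hA
  calc _ = _ := step0
    _ ≤ _ := step1
    _ = _ := step2
    _ ≤ _ := step3
    _ = _ := step4

/-- **THE TWISTED CONE STEP (`e ∉ τ`).**  If every member of the up-set `𝒰` contains `e`, then `N_τ(𝒰ᵉ,𝒱ᵉ,𝒲ᵉ) ≤ 3·N_τ(𝒰,𝒱,𝒲)`. [this work] -/
theorem threePartNT_lift_le_three_mul (heτ : e ∉ τ) (h𝒰 : IsUpperSet 𝒰) (h𝒱 : IsUpperSet 𝒱) (h𝒲 : IsUpperSet 𝒲)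
    (h𝒰e : ∀ T ∈ 𝒰, e ∈ T) :
    threePartNT τ ({R : Set ι | insert e R ∈ 𝒰}) ({R : Set ι | insert e R ∈ 𝒱}) ({R : Set ι | insert e R ∈ 𝒲}) ≤ 3 * threePartNT τ 𝒰 𝒱 𝒲 := by
  have htop := topT_eq_pin τ e (𝒱 := 𝒱) (𝒲 := 𝒲) heτ h𝒰e
  have htop' := topT_lift_eq_three_mul τ e (𝒰 := 𝒰) (𝒱 := 𝒱) (𝒲 := 𝒲) heτ
  have hd1 := deeT_one_le_pin τ e heτ h𝒰e h𝒱 h𝒲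
  have hd1' := deeT_one_lift_eq_three_mul τ e (𝒰 := 𝒰) (𝒱 := 𝒱) (𝒲 := 𝒲) heτ
  have hd2 := deeT_two_eq_pin τ e (𝒱 := 𝒱) (𝒲 := 𝒲) heτ h𝒰e
  have hd2' := deeT_two_lift_eq_three_mul τ e (𝒰 := 𝒰) (𝒱 := 𝒱) (𝒲 := 𝒲) heτ
  have hg2 := deeT_two_add_gain_le τ e (𝒰 := 𝒰) (𝒲 := 𝒲) h𝒱
  have hd3 := deeT_two_eq_pin τ e (𝒱 := 𝒲) (𝒲 := 𝒱) heτ h𝒰e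
  have hd3' := deeT_two_lift_eq_three_mul τ e (𝒰 := 𝒰) (𝒱 := 𝒲) (𝒲 := 𝒱) heτ
  have hg3 := deeT_two_add_gain_le τ e (𝒰 := 𝒰) (𝒲 := 𝒱) h𝒲
  have ht := teeT_eq_pin τ e (𝒱 := 𝒱) (𝒲 := 𝒲) heτ h𝒰e
  have ht' := teeT_lift_eq_three_mul τ e (𝒰 := 𝒰) (𝒱 := 𝒱) (𝒲 := 𝒲) heτ
  have hsplit := teeT_pin_le_add τ e (𝒰 := 𝒰) (𝒱 := 𝒱) (𝒲 := 𝒲) heτ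
  have hX := incrT_two_le τ e (𝒱 := 𝒱) heτ h𝒰 h𝒲
  have hY := incrT_three_le τ e (𝒲 := 𝒲) heτ h𝒰 h𝒱
  unfold threePartNT
  rw [htop, htop', hd1', hd2, hd2', hd3, hd3', ht, ht']
  push_cast
  omega

end TwistedConeStep

/-- **Twisted three-partition positivity with one principal slot disjoint from the twist**: for every finite ι, twist τ, finset S with
`↑S ∩ τ = ∅` and all up-sets 𝒱, 𝒲: `0 ≤ threePartNT τ {T | S ⊆ T} 𝒱 𝒲`. [this work] -/
theorem threePartNT_principal_finset_nonneg_of_disjoint (τ : Set ι) (S : Finset ι) :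
    (∀ s ∈ S, s ∉ τ) → ∀ {𝒱 𝒲 : Set (Set ι)}, IsUpperSet 𝒱 → IsUpperSet 𝒲 → 0 ≤ threePartNT τ {T : Set ι | (S : Set ι) ⊆ T} 𝒱 𝒲 := by
  induction S using Finset.induction_on with
  | empty =>
    intro _ 𝒱 𝒲 h𝒱 h𝒲
    have h : {T : Set ι | ((∅ : Finset ι) : Set ι) ⊆ T} = (Set.univ : Set (Set ι)) := by
      ext T; simp
    rw [h]
    exact threePartNT_univ_nonneg τ h𝒱 h𝒲
  | @insert e S he ih =>
    intro hS 𝒱 𝒲 h𝒱 h𝒲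
    have heτ : e ∉ τ := hS e (Finset.mem_insert_self e S)
    have hS' : ∀ s ∈ S, s ∉ τ := fun s hs => hS s (Finset.mem_insert_of_mem hs)
    have hU : IsUpperSet {T : Set ι | ((insert e S : Finset ι) : Set ι) ⊆ T} :=
      fun A B hAB hA => Set.Subset.trans hA hAB
    have hUe : ∀ T ∈ {T : Set ι | ((insert e S : Finset ι) : Set ι) ⊆ T}, e ∈ T :=
      fun T hT => hT (by simp)
    have h3 := threePartNT_lift_le_three_mul τ e heτ hU h𝒱 h𝒲 hUe
    rw [liftAt_principal_insert e S he] at h3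
    have h0 := ih hS' (isUpperSet_liftAt e h𝒱) (isUpperSet_liftAt e h𝒲)
    linarith

/-- The same for an arbitrary generating set `S ⊆ ι` with `S ∩ τ = ∅`. [this work] -/
theorem threePartNT_principal_nonneg_of_disjoint (τ S : Set ι) (hS : Disjoint S τ) {𝒱 𝒲 : Set (Set ι)}
    (h𝒱 : IsUpperSet 𝒱) (h𝒲 : IsUpperSet 𝒲) : 0 ≤ threePartNT τ {T : Set ι | S ⊆ T} 𝒱 𝒲 := by
  have h := threePartNT_principal_finset_nonneg_of_disjoint τ S.toFinite.toFinset
    (fun s hs => Set.disjoint_left.1 hS ((Set.Finite.mem_toFinset _).1 hs)) h𝒱 h𝒲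
  simp only [Set.Finite.coe_toFinset] at h
  exact h

end Summit.CriticalPhenomena.PercolationContinuityZ3.Theorems.ThreePartition
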